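import Literature.MathematicalPhysics.QuantumManyBody.OneBodyCurrentGain
import HarnessLib

/-!
# Homogeneity of the one-body density, current and unwinding gain under `Φ ↦ cΦ`

Topic `Literature/MathematicalPhysics/QuantumManyBody`, companion of `OneBodyCurrentGain.lean`
(definition item `defn-CoarseModeRayPOVM`; route `BECIroning` of
`AtomisticToContinuum/BoseEinsteinCondensation`, items `IroningLink` / `IroningCost`). The route
applies `oneBodyDensity`, `oneBodyCurrent`, `phaseGain` and `maxPhaseGain = GAIN*` to the
*unnormalised* record-conditional states `K_zΨ` (`coarseModeRayPOVM`) and integrates over the record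
law `dσ(z)`; the passage to the normalised conditional states `K_zΨ/‖K_zΨ‖`
(`PeriodicTrialState.conditionalState` of `CoarseModeRayPOVMFormCore.lean`), to which the
variational principle applies, is the bookkeeping proved here: all four objects are quadratic in the
wave function,

* `particleCurrent_const_smul`, `oneBodyDensity_const_smul`, `oneBodyCurrent_const_smul`:
  `J(cΦ) = |c|²J(Φ)`, `n_{cΦ} = |c|² n_Φ`, `j_{cΦ} = |c|² j_Φ`;
* `phaseGain_const_smul`: `GAIN(θ; cΦ) = |c|² GAIN(θ; Φ)`;
* **`maxPhaseGain_const_smul`: `GAIN*(cΦ) = |c|² GAIN*(Φ)`**, so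
  `∫ GAIN*(K_zΨ) dσ = ∫ ‖K_zΨ‖² GAIN*(K_zΨ/‖K_zΨ‖) dσ` is the outcome-weighted average.

No differentiability hypotheses (`fderiv (c • Φ) = c • fderiv Φ` holds for every `c ∈ ℂ`,
`fderiv_const_smul_field`); no definitions, no named facts.

## References

* [LSSY2005] E. H. Lieb, R. Seiringer, J. P. Solovej, J. Yngvason, *The Mathematics of the Bose Gas
  and its Condensation*, Birkhäuser 2005: §1.2 (1.17)–(1.18) (one-particle density matrix),
  §5.2 (5.19)–(5.23) (gauge transformation).
-/

noncomputable section

open MeasureTheory Metric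
open scoped ENNReal NNReal ComplexConjugate

namespace Literature.MathematicalPhysics.QuantumManyBody.BoseGas

variable {N : ℕ}

/-- `∂_{i,k}(cΦ) = c ∂_{i,k}Φ` (no differentiability needed: `c = 0` or `c` invertible). [folklore] -/
theorem fderiv_const_smul_config_apply (c : ℂ) (Φ : Config N → ℂ) (X : Config N) (V : Config N) :
    fderiv ℝ (c • Φ) X V = c * fderiv ℝ Φ X V := by
  rw [fderiv_const_smul_field c]
  rfl

/-- `J_{i,k}(cΦ) = |c|² J_{i,k}(Φ)`: the particle current is quadratic in the wave function. [folklore] -/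
theorem particleCurrent_const_smul (c : ℂ) (i : Fin N) (k : Fin 3) (Φ : Config N → ℂ) (X : Config N) :
    particleCurrent i k (c • Φ) X = ‖c‖ ^ 2 * particleCurrent i k Φ X := by
  unfold particleCurrent
  rw [fderiv_const_smul_config_apply, Pi.smul_apply, smul_eq_mul, map_mul]
  have h1 : conj c * conj (Φ X) * (c * fderiv ℝ Φ X (Pi.single i (EuclideanSpace.single k 1))) =
      (c * conj c) * (conj (Φ X) * fderiv ℝ Φ X (Pi.single i (EuclideanSpace.single k 1))) := by
    ring
  rw [h1, Complex.mul_conj, Complex.im_ofReal_mul, Complex.normSq_eq_norm_sq]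

/-- `n_{cΦ} = |c|² n_Φ`. [folklore] -/
theorem oneBodyDensity_const_smul (L : ℝ) (c : ℂ) :
    ∀ (N : ℕ) (Φ : Config N → ℂ) (x : Space),
      oneBodyDensity L N (c • Φ) x = ‖c‖ ^ 2 * oneBodyDensity L N Φ x
  | 0, _, _ => by simp [oneBodyDensity]
  | n + 1, Φ, x => by
    simp only [oneBodyDensity, Pi.smul_apply, smul_eq_mul, norm_mul, mul_pow, Finset.mul_sum]
    exact Finset.sum_congr rfl fun i _ => (integral_const_mul _ _)

/-- `j_{cΦ} = |c|² j_Φ`. [folklore] -/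
theorem oneBodyCurrent_const_smul (L : ℝ) (c : ℂ) :
    ∀ (N : ℕ) (Φ : Config N → ℂ) (k : Fin 3) (x : Space),
      oneBodyCurrent L N (c • Φ) k x = ‖c‖ ^ 2 * oneBodyCurrent L N Φ k x
  | 0, _, _, _ => by simp [oneBodyCurrent]
  | n + 1, Φ, k, x => by
    simp only [oneBodyCurrent, particleCurrent_const_smul, Finset.mul_sum]
    exact Finset.sum_congr rfl fun i _ => (integral_const_mul _ _)

/-- **The gain is quadratic in the wave function**: `GAIN(θ; cΦ) = |c|² GAIN(θ; Φ)`. [folklore] -/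
theorem phaseGain_const_smul (L : ℝ) (N : ℕ) (c : ℂ) (Φ : Config N → ℂ) (θ : Space → ℝ) :
    phaseGain L N (c • Φ) θ = ‖c‖ ^ 2 * phaseGain L N Φ θ := by
  unfold phaseGain
  simp only [oneBodyDensity_const_smul, oneBodyCurrent_const_smul]
  have h1 : (fun x => ∑ k : Fin 3, fderiv ℝ θ x (EuclideanSpace.single k 1) *
      (‖c‖ ^ 2 * oneBodyCurrent L N Φ k x)) = fun x => ‖c‖ ^ 2 * ∑ k : Fin 3,
        fderiv ℝ θ x (EuclideanSpace.single k 1) * oneBodyCurrent L N Φ k x := by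
    funext x
    rw [Finset.mul_sum]
    exact Finset.sum_congr rfl fun k _ => by ring
  have h2 : (fun x => (∑ k : Fin 3, fderiv ℝ θ x (EuclideanSpace.single k 1) ^ 2) *
      (‖c‖ ^ 2 * oneBodyDensity L N Φ x)) = fun x => ‖c‖ ^ 2 * ((∑ k : Fin 3,
        fderiv ℝ θ x (EuclideanSpace.single k 1) ^ 2) * oneBodyDensity L N Φ x) := by
    funext x
    ring
  rw [h1, h2, integral_const_mul, integral_const_mul]
  ring

/-- **`GAIN*` is quadratic in the wave function**: `GAIN*(cΦ) = |c|² GAIN*(Φ)` — so the record average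
`∫ GAIN*(K_zΨ) dσ(z)` of the unnormalised conditional states is the outcome-weighted average
`∫ ‖K_zΨ‖² GAIN*(K_zΨ/‖K_zΨ‖) dσ(z)` of the normalised ones. [folklore] -/
theorem maxPhaseGain_const_smul (L : ℝ) (N : ℕ) (c : ℂ) (Φ : Config N → ℂ) :
    maxPhaseGain L N (c • Φ) = ENNReal.ofReal (‖c‖ ^ 2) * maxPhaseGain L N Φ := by
  unfold maxPhaseGain
  simp only [phaseGain_const_smul, ENNReal.ofReal_mul (sq_nonneg ‖c‖), ENNReal.mul_iSup]

end Literature.MathematicalPhysics.QuantumManyBody.BoseGas
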